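import Summits.ValiantsHypothesis.ValiantsHypothesis.Theorems.LacunarySymmetroidMatrixDescartesDoorA26WallBubblingBubblingTwistedRolle

/-!
# Wall bubbling for `DoorA26` — (W) chain piece: CLASS MOMENTS (Taylor form of a merging class)

HONEST FRAMING.  Chain lemma for obligation (W) `stub_weylFaces` of `Cruxes/DoorA26/Lines/wall_bubbling.lean` (stmt-ValiantsHypothesis-19979
`DoorA26`; OPEN, typed, never asserted), re-pointed seat val-sym-door-p1 g13 (W2 #6).  LEVEL SELECTION in the reduction «ConfluentDoor26 ⇒
Stmt.weylFaces_generic» (seat report DOOR-A-P1-REPORT §68 (g) step (1)): inside a value class with member deviations `ε_p → 0` the class function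
`Σ_p a_p e^{ε_p t}` is its MOMENT polynomial `Σ_{m<n} M_m t^m / m!`, `M_m = Σ_p a_p ε_p^m`, up to an explicit remainder of order `(max|ε_p|·|t|)^n`
— uniformly on a window, for every truncation order `n ≥ 1`.  This file records that bound (`classMoment_taylor`, from Mathlib's `Real.exp_bound`)
and its window form (`classMoment_taylor_window`).  The moments of the DERIVATIVE tower are the moments of the reweighted coefficients
`a_p (E + ε_p)^j` (no new lemma needed).  No new definitions; nothing here bears on `DoorA26`, `MatrixDescartes` (stmt-ValiantsHypothesis-18050)
or `VP ≠ VNP`.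

[folklore] Taylor's theorem for `exp` with Lagrange-type remainder (`Real.exp_bound`).
-/

-- `Summit.ValiantsHypothesis.ValiantsHypothesis.…` repeats a component by the D-0017 layout
-- (single-conjunct summit), which the `dupNamespace` linter flags; the name is mandated.
set_option linter.dupNamespace false

namespace Summit.ValiantsHypothesis.ValiantsHypothesis.Theorems.LacunarySymmetroidMatrixDescartes.WallBubbling

open Finset
open scoped BigOperators

/-- **CLASS MOMENTS.**  For `|ε_i t| ≤ 1` and `n ≥ 1`:
`|Σ_i a_i e^{ε_i t} − Σ_{m<n} (Σ_i a_i ε_i^m) t^m/m!| ≤ (Σ_i |a_i|·|ε_i t|^n)·((n+1)/(n!·n))`. [folklore] -/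
theorem classMoment_taylor {ι : Type*} [Fintype ι] (a ε : ι → ℝ) (t : ℝ) {n : ℕ} (hn : 0 < n)
    (h1 : ∀ i, |ε i * t| ≤ 1) :
    |∑ i, a i * Real.exp (ε i * t) - ∑ m ∈ Finset.range n, (∑ i, a i * ε i ^ m) * t ^ m / m.factorial|
      ≤ (∑ i, |a i| * |ε i * t| ^ n) * ((n.succ : ℝ) / (n.factorial * n)) := by
  -- regroup the moment polynomial letter by letter
  have hre : ∑ m ∈ Finset.range n, (∑ i, a i * ε i ^ m) * t ^ m / m.factorial
      = ∑ i, a i * ∑ m ∈ Finset.range n, (ε i * t) ^ m / m.factorial := by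
    simp only [Finset.sum_mul, Finset.sum_div]
    rw [Finset.sum_comm]
    refine Finset.sum_congr rfl fun i _ => ?_
    rw [Finset.mul_sum]
    refine Finset.sum_congr rfl fun m _ => ?_
    rw [mul_pow]; ring
  rw [hre, ← Finset.sum_sub_distrib]
  calc |∑ i, (a i * Real.exp (ε i * t) - a i * ∑ m ∈ Finset.range n, (ε i * t) ^ m / m.factorial)|
      ≤ ∑ i, |a i * Real.exp (ε i * t) - a i * ∑ m ∈ Finset.range n, (ε i * t) ^ m / m.factorial| :=
        Finset.abs_sum_le_sum_abs _ _
    _ = ∑ i, |a i| * |Real.exp (ε i * t) - ∑ m ∈ Finset.range n, (ε i * t) ^ m / m.factorial| := by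
        refine Finset.sum_congr rfl fun i _ => ?_
        rw [← mul_sub, abs_mul]
    _ ≤ ∑ i, |a i| * (|ε i * t| ^ n * ((n.succ : ℝ) / (n.factorial * n))) := by
        refine Finset.sum_le_sum fun i _ => ?_
        exact mul_le_mul_of_nonneg_left (Real.exp_bound (h1 i) hn) (abs_nonneg _)
    _ = (∑ i, |a i| * |ε i * t| ^ n) * ((n.succ : ℝ) / (n.factorial * n)) := by
        rw [Finset.sum_mul]
        refine Finset.sum_congr rfl fun i _ => ?_
        ring

/-- Window form: deviations `|ε_i| ≤ w` (`0 ≤ w`), window `|t| ≤ R`, `w R ≤ 1` ⇒ remainder `≤ (Σ|a_i|)·(wR)^n·((n+1)/(n!·n))`. [folklore] -/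
theorem classMoment_taylor_window {ι : Type*} [Fintype ι] (a ε : ι → ℝ) (w R t : ℝ) {n : ℕ} (hn : 0 < n)
    (hw0 : 0 ≤ w) (hw : ∀ i, |ε i| ≤ w) (ht : |t| ≤ R) (hwR : w * R ≤ 1) :
    |∑ i, a i * Real.exp (ε i * t) - ∑ m ∈ Finset.range n, (∑ i, a i * ε i ^ m) * t ^ m / m.factorial|
      ≤ (∑ i, |a i|) * (w * R) ^ n * ((n.succ : ℝ) / (n.factorial * n)) := by
  have hεt : ∀ i, |ε i * t| ≤ w * R := fun i => by
    rw [abs_mul]; exact mul_le_mul (hw i) ht (abs_nonneg _) hw0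
  have h1 : ∀ i, |ε i * t| ≤ 1 := fun i => (hεt i).trans hwR
  refine (classMoment_taylor a ε t hn h1).trans ?_
  have hc : 0 ≤ ((n.succ : ℝ) / (n.factorial * n)) := by positivity
  rw [Finset.sum_mul, Finset.sum_mul, Finset.sum_mul]
  refine Finset.sum_le_sum fun i _ => ?_
  have : |ε i * t| ^ n ≤ (w * R) ^ n := pow_le_pow_left₀ (abs_nonneg _) (hεt i) n
  have ha : 0 ≤ |a i| := abs_nonneg _
  nlinarith [mul_nonneg ha (sub_nonneg.mpr this)]

/-! ## Moment inversion for the classes at a generic Weyl face (doubleton `ε = (0,w)`, triple `ε = (0,w,2w)`)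

The normalisation lower bounds of LEVEL SELECTION: the coefficients are recovered from the moments with losses `w^{-m}` (Vandermonde). -/

/-- Doubleton class `ε = (0, w)`: `b = M₁ / w`, `a = M₀ − M₁ / w`. [folklore] -/
theorem moments_two_inv (a b w : ℝ) (hw : w ≠ 0) :
    b = (a * 0 ^ 1 + b * w ^ 1) / w ∧ a = (a * 0 ^ 0 + b * w ^ 0) - (a * 0 ^ 1 + b * w ^ 1) / w := by
  constructor
  · field_simp; ring
  · field_simp; ring

/-- Triple class `ε = (0, w, 2w)` (moments `M₀ = a+b+c`, `M₁ = (b+2c)w`, `M₂ = (b+4c)w²`):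
`c = (M₂/w² − M₁/w)/2`, `b = 2M₁/w − M₂/w²`, `a = M₀ − b − c`. [folklore] -/
theorem moments_three_inv (a b c w : ℝ) (hw : w ≠ 0) :
    c = ((b * w ^ 2 + c * (2 * w) ^ 2) / w ^ 2 - (b * w + c * (2 * w)) / w) / 2 ∧
    b = 2 * ((b * w + c * (2 * w)) / w) - (b * w ^ 2 + c * (2 * w) ^ 2) / w ^ 2 ∧
    a = (a + b + c) - (2 * ((b * w + c * (2 * w)) / w) - (b * w ^ 2 + c * (2 * w) ^ 2) / w ^ 2)
          - ((b * w ^ 2 + c * (2 * w) ^ 2) / w ^ 2 - (b * w + c * (2 * w)) / w) / 2 := by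
  refine ⟨?_, ?_, ?_⟩ <;> field_simp <;> ring

/-- Hence the doubleton coefficients are bounded by the normalised moments: `|b| ≤ |M₁|/|w|`, `|a| ≤ |M₀| + |M₁|/|w|`. [folklore] -/
theorem moments_two_bound (a b w : ℝ) (hw : w ≠ 0) :
    |b| ≤ |a * 0 ^ 1 + b * w ^ 1| / |w| ∧ |a| ≤ |a * 0 ^ 0 + b * w ^ 0| + |a * 0 ^ 1 + b * w ^ 1| / |w| := by
  have h1 : a * 0 ^ 1 + b * w ^ 1 = b * w := by ring
  have h0 : a * 0 ^ 0 + b * w ^ 0 = a + b := by ring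
  rw [h1, h0, abs_mul, mul_div_assoc, div_self (abs_ne_zero.mpr hw), mul_one]
  constructor
  · exact le_rfl
  · calc |a| = |(a + b) - b| := by ring_nf
      _ ≤ |a + b| + |b| := abs_sub _ _

end Summit.ValiantsHypothesis.ValiantsHypothesis.Theorems.LacunarySymmetroidMatrixDescartes.WallBubbling
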